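import Mathlib
import HarnessLib
import HarnessLib.Audit
import Summits.ValiantsHypothesis.Statement
import Literature.Computability.AlgebraicComplexity.DeterminantalComplexity
import Literature.Computability.AlgebraicComplexity.ValiantClasses
import Literature.Computability.AlgebraicComplexity.ValiantConjectureProofs
import HarnessLib.Audit.Status.Attr

/-!
Route: LiftNullstellensatz

DORMANT since 2026-08-29T19:43:20Z (census g0: costume|duplicate of route-ValiantsHypothesis-DetQP; reader census-reader-26-g0) — unstaffed, not closed; items shared with open routes are served there. `ledger route dormant <id> --off` reactivates.

# Route LiftNullstellensatz — VH as lift avoidance — invariant Nullstellensatz certificates against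
the tensor-train variety

It suffices to show X = LIFT AVOIDANCE (card invariant-nullstellensatz-lift, spine): for every c,
for all large n, EVERY
word tensor Ψ : ([n]×[n])^n → ℂ whose commutative image Σ_w Ψ(w)·x_{w_1}⋯x_{w_n} is per_n (a "lift"
of per_n; the lifts
form the affine space L_n = s_per + ker Sym) has some sequential flattening (cut k | n−k) of rank >
2^((log₂ n + c)^c).
By Nisan's characterisation (width of a homogeneous ABP at layer k = rank of the k-th flattening of
the word tensor it
computes) X says exactly that per_n has no homogeneous algebraic branching program of
quasi-polynomial width, i.e. L_n
misses the tensor-train variety N_w = {all sequential flattening ranks ≤ w} for w = 2^polylog;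
dually (Hilbert) some
polynomial in the ideal of (w+1)-minors is ≡ 1 on L_n, and by Reynolds such a certificate may be
taken S_n×S_n-invariant.
Lean: `∀ c : ℕ, ∃ n₀ : ℕ, ∀ n ≥ n₀, ∀ Ψ : (Fin n → Fin n × Fin n) → ℂ, (∑ w : Fin n → Fin n × Fin n,
Ψ w • ∏ t, (MvPolynomial.X (w t) : MvPolynomial (Fin n × Fin n) ℂ)) =
Literature.Computability.AlgebraicComplexity.perPoly (Fin n) ℂ → ∃ (k l : ℕ) (h : k + l = n), 2 ^
((Nat.log 2 n + c) ^ c) < (Matrix.of fun (u : Fin k → Fin n × Fin n) (v : Fin l → Fin n × Fin n) =>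
Ψ (fun t => Fin.append u v (Fin.cast h.symm t))).rank`

## Assembly
Pure bookkeeping over PROVED cone facts (checked sorry-free in the planner's AssemblyCheck.lean): if
VP ℂ = VNP ℂ then
perFamily ℂ ∈ VP ℂ (perFamily_mem_VNP_holds), hence IsVPFamily (per_n) (mem_VP_ofFintype_iff_holds);
PerLiftQPOfVP gives c and
lifts of TT-rank ≤ 2^((log₂ n + c)^c) for every n; X at this c gives n₀ and, for the lift at n₀, a
cut of larger rank —
contradiction. DetReprLift + isQPBounded_determinantalComplexity_of_isVPFamily_holds +
hasDetRepr_determinantalComplexity_holds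
is the intended proof of PerLiftQPOfVP.

Rationale: WHY THIS LINE. Homogeneous ABP width of a form f is min{TT-rank(Ψ) : Ψ ∈ Sym⁻¹(f)} (Nisan1991
applied to noncommutative preimages), so
"per is hard for ABPs" becomes "an explicit AFFINE space L_n avoids an explicit DETERMINANTAL
variety N_w (ideal = minors of
flattenings)", and the weak Nullstellensatz turns the lower bound into the existence of a dual
certificate Σ g_i·minor_i ≡ 1
on L_n; algebraically natural proofs (ForbesShpilkaVolk2018) and GCT separating modules
(Grochow2015) are the PULLBACK
certificates D∘Sym (constant on every fibre of Sym), while a general certificate need be constant on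
ONE fibre, and the
certificates of a fixed degree form an S_n×S_n-stable linear space, so symmetry is free on the dual
side (Reynolds) although
it costs exponentially on the primal side (Grenet/Landsberg–Ressayre). Imported areas: LP/SOS-style
duality and
symmetry-reduced certificate search (flag-algebra practice), invariant theory of V^{⊗n} (Schur–Weyl
isotypics carry
ker Sym), tensor networks (TT-rank; purification gaps, arXiv:1512.05709, as heuristic only), proof
complexity
(Nullstellensatz degree; IPS, GrochowPitassi2018, SanthanamTzameret2021, which study 'per ≠ small
circuit' systems in
skeleton-with-constants coordinates). What prior routes do not do: DetQP works with local invariants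
of {det_m = 0},
GCTMult/IntegralGCT with padded orbit closures of det; here there is no det, no padding, the ideal
is explicit, and the
object to be found is a DUAL certificate with free symmetry, minable at n = 3, 4; X is extensionally
the Extended Valiant
Hypothesis (= DetQP's thesis in dc-language, BurgisserClausenShokrollahi1997 (21.41)), deliberately
re-coordinatised.
The negatives index is empty; the first unconditional rung (width ≥ 3) rests on PROVED cone facts
(vonzurGathen1987 Lemma 2.3
in tree) and the assembly on the PROVED VP ⇒ qp-dc fact.

RANKED CRUXES. #0 LiftAvoidanceQP (target) — X as in § Thesis: for every c, eventually every lift Ψ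
of per_n has a sequential flattening of rank > 2^((log₂ n + c)^c) (no quasi-polynomial-width
homogeneous ABP for the permanent). (why it might fail: X is the Extended Valiant Hypothesis VNP ⊄
VQP (BCS97 (21.41), open) in ABP-width form, strictly stronger than VH: false if per_n has
homogeneous ABPs of width n^{O(log n)}; known: n/2 < width ≤ C(n,⌊n/2⌋).)
[BurgisserClausenShokrollahi1997, Nisan1991, Burgisser2000, Grenet2011, MignonRessayre2004]
#2 PolyDegreeCertificates (crux) — the card's Xi2/Xi3 made falsifiable at the VBP level: for every c
there are d, n₀ such that for all n ≥ n₀ there is a Nullstellensatz certificate of degree ≤ n^d in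
lift coordinates — polynomial multipliers g_p on generators p that are either (n^c+1)-minors of the
symbolic sequential flattenings or the linear equations of the fibre L_n = Sym⁻¹(per_n), with Σ
g_p·p = 1 and every deg(g_p·p) ≤ n^d. By soundness this gives: eventually no lift of per_n has
TT-rank ≤ n^c (VNP ⊄ VBP_hom); by Reynolds a certificate of the same degree can be taken
S_n×S_n×ℤ/2-invariant, which is how it is to be FOUND (symmetry-reduced linear algebra at n = 3, 4,
then a uniform family). [difficulty: open-problem] (why it might fail: Nullstellensatz degrees are
often linear in the number of variables (here n^{2n}) already for PHP/Tseitin systems (BIKPRS97,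
Razborov98); short algebraic proofs of 'per is hard' are what GP18/ST21 tie to major conjectures;
degree 2^{Ω(n)} kills the mining programme.) [SanthanamTzameret2021, GrochowPitassi2018,
BussImpagliazzoKrajicekPudlakRazborovSgall1997, Razborov1998, ForbesShpilkaVolk2018, Jelonek2005]
#3 LiftWidthSuperlinear (crux) — first unconditional rung past every known engine: there is ε > 0
such that for all large n every lift Ψ of per_n has a sequential flattening of rank ≥ n^{1+ε}
(homogeneous ABP width of per_n is superlinear). Any proof must use the COUPLING of the cuts through
one lift (the per-cut two-row/Pieri projection is only the decoupled product rank, stuck at the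
singular-locus ceiling) or a certificate of degree ≥ 1 in the minors. [difficulty: XL] (why it might
fail: width O(n) for per_n is excluded by nothing known (it would give dc(per_n) = O(n²), matching
Mignon–Ressayre); all engines stop at linear: Kumar's singular-locus argument (codim sing Z(per_n) ≤
2n), Hessian via dc ≤ 1+(n−1)·width, flattenings equal for per/det.) [Kumar2019,
ChatterjeeKumarSheVolk2022, MignonRessayre2004, vonzurGathen1987, Landsberg2017, Nisan1991]
#4 LiftWidthPerFour (crux) — calibration point of the mining programme (analogue of dc(per_3) = 7):
Grenet's width C(4,2) = 6 is optimal for per_4 — every lift of per_4 has a sequential flattening of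
rank ≥ 6 (equivalently no homogeneous ABP of widths (≤5, ≤5, ≤5)). The first instance where neither
Kumar+von zur Gathen (≥ 3) nor dc(per_4) ≥ 8 decides; a proof is expected to BE an invariant
certificate at (n, w) = (4, 5), the data from which the uniform family is read. [difficulty: L] (why
it might fail: per_4 may have a non-Grenet lift of middle rank 5 (16·(4+20+20+4) = 768 unknowns vs
C(19,4) = 3876 equations; numerically searchable); only width ≥ 3 is known, and small cases do
surprise (product rank of per_3 is 4 < naive, IltenTeitler2016).) [Grenet2011,
AlperBogartVelasco2017, IltenTeitler2016, BlaserIkenmeyerMahajanPandeySaurabh2020, Kumar2019]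
#9 PerLiftQPOfVP (support) — assembly glue (known in print): if the permanent family is a VP family
then per_n has lifts of quasi-polynomial TT-rank — VP ⊆ VQP = qp-size formulas (VSBR83 + Hyafil;
BCS97 Thm (21.33), in tree as the PROVED fact
isQPBounded_determinantalComplexity_of_isVPFamily_holds) and a formula / determinantal
representation of size s yields a homogeneous ABP, hence a lift, of width poly(s) (Valiant's
series–parallel construction or Mahajan–Vinay/Berkowitz for det_m, then substitution +
homogenisation: rank ≤ (m+1)·(m²+1)). [difficulty: L] [BurgisserClausenShokrollahi1997,
ValiantSkyumBerkowitzRackoff1983, Valiant1979, MahajanVinay1997, Berkowitz1984, Nisan1991]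
#9 DetReprLift (support) — the natural general form of the glue: there is d such that every form f,
homogeneous of degree N, with an affine determinantal representation of size m has a word lift of
length N with all sequential flattening ranks ≤ (m+2)^d (lift of det_m of TT-rank ≤ m²+1 by
Mahajan–Vinay clow sequences or Le Verrier/Newton identities; substitute the affine entries, expand,
keep the degree-N words: rank ≤ (m+1)(m²+1)). With the proved cone facts (VP ⇒ qp dc, dc attained)
it yields PerLiftQPOfVP. [difficulty: L] [MahajanVinay1997, Berkowitz1984, Nisan1991,
MignonRessayre2004]
#9 LiftWidthGeThree (support) — the rung available now: for n ≥ 3 every lift of per_n has a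
sequential flattening of rank ≥ 3 (in particular Grenet's width C(3,1) = 3 is optimal for per_3).
Proof in hand: a cut of rank r ≤ 2 writes per_n = g₁h₁ + g₂h₂ with homogeneous g_i, h_i of positive
degree, so I = (g₁,g₂,h₁,h₂) ∋ per_n and all ∂per_n; a minimal prime over I has height ≤ 4 (Krull,
Mathlib) but ≥ 5 (von zur Gathen 1987 Lemma 2.3 = PROVED tree fact
vonzurGathen1987_singPerm_height_holds) — Kumar's homogeneous-ABP argument. [difficulty:
provable-now] [Kumar2019, vonzurGathen1987, ChatterjeeKumarSheVolk2022]

TWO-LAYER PLAN. Foreseen glued splits (k ≤ 3, depth 1), nothing filed now: PolyDegreeCertificates ⇐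
SmallCertificates (explicit S_3×S_3×ℤ/2-
invariant certificates at (n,w) = (3,2) and (4,≤5) with their degrees and isotypic supports) →
UniformFamily (the conjectured
n-uniform invariant family, typed from the data) → PolyDegreeCertificates; LiftWidthSuperlinear ⇐
CouplingLemma (a rank
inequality mixing two cuts of one lift that fails for decoupled product ranks) → PerIsotypicEstimate
→ LiftWidthSuperlinear;
LiftWidthPerFour ⇐ MiddleCutFive (no lift with middle rank ≤ 5 and outer ranks ≤ 5) directly by
certificate, or by a
Fano-scheme computation; PerLiftQPOfVP ⇐ DetReprLift + cone facts (glue-by the planner's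
arithmetic).

KILL CRITERIA. A quasi-polynomial-width homogeneous ABP for per_n refutes LiftAvoidanceQP and closes
the route (and moots DetQP's thesis, the
same Prop in dc-language): close --reason refuted:LiftAvoidanceQP. A super-polynomial (e.g.
2^{Ω(n)}) lower bound on the
Nullstellensatz degree of the w = n^c lift systems refutes PolyDegreeCertificates: the
certificate-MINING programme is dead;
pivot to LiftWidthSuperlinear by structural (non-certificate) means only if something concrete is in
hand, else close
refuted:PolyDegreeCertificates. A width-5 lift of per_4 refutes LiftWidthPerFour only: recalibrate
(Grenet not optimal),
restate the rung at the true value, keep the line. DetQP.DetqpThesis or GCTMult proved elsewhere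
moots X (implied).

NOT DECOMPOSED YET. The Reynolds lemma (invariant certificate of the same degree exists whenever one
does — finite-group averaging plus torus
weight-0 projection; provers attach it with --supports); the two-row/Pieri localisation (per cut it
is exactly the decoupled
(k,n−k) product rank of card balanced-strength-permanent, so it is NOT where coupling lives —
recorded, not filed); graded
lifts = set-multilinear ABPs (column-torus-invariant lifts have cut-1 rank ≥ n by a Hall-type
argument, and plausibly middle
rank ≥ C(n,k), but the same holds for det_n, so primal symmetry cannot separate — calibration only,
cf. arXiv:2312.15874 and the
2026 multilinear-ABP barrier arXiv:2604.00746); the QI purification dictionary (heuristic);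
Literature definitions
liftTTRank / IsWordLift (requested below; items inline the notion for now); constants d in
DetReprLift (any polynomial works).

CHEAPEST FALSIFIER. (1) Numerical/Gröbner search for a lift of per_4 with flattening ranks (4,5,4):
768 unknowns (edge labels of a width-(4,5,4)
homogeneous ABP), 3876 coefficient equations — a kit job for a refuter (alternating least squares
over ℂ, or exact solving
over F_p then lifting); a solution refutes LiftWidthPerFour in minutes. (2) Linear-algebra
feasibility of invariant
certificates of degree w+1 … w+3 at (n,w) = (3,2) after symmetry reduction (orbits of the
2·C(9,3)·C(81,3) = 14.3M minors
restricted to the 564-dimensional fibre): if even (3,2) — where width ≥ 3 is a theorem — needs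
visibly growing degree,
PolyDegreeCertificates is implausible. Not run here (planner seat, compute-free hub); lookups run:
no ABP-width value for
per_4 and no linear-space-in-Z(per_n) classification found in zbMATH/Crossref.

NUMBERS. n/2 < (dc(per_n)−1)/(n−1) ≤ width(per_n) ≤ C(n,⌊n/2⌋) (MignonRessayre2004 n²/2 with dc ≤ 1
+ Σ_k w_k; Grenet2011); width ≥ 3
for n ≥ 3 (Kumar2019-type argument + vonzurGathen1987 Lemma 2.3: height ≥ 5; codim sing Z(per_n) ≤
2n caps this engine at n);
catalecticant ranks C(n,k)² for per_n AND det_n (Landsberg2017 §6.2.2, barrier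
PartialDerivativesDetPerm) while width(det_m) ≤
m²+1 (Mahajan–Vinay 1997) — any width method must separate per from det; n = 3: dim V^{⊗3} = 729,
Sym³ℂ⁹ = 165, fibre
dimension 564, 3-minors per cut C(9,3)·C(81,3) = 7,166,880; n = 4: Grenet widths (4,6,4), search
space 768 unknowns / 3876
equations; trivial certificate-degree upper bounds are d^{min(#vars,#gens)} (Kollár 1988,
Jelonek2005), i.e. useless; items at
open: 8 (1 target, 3 cruxes, 3 support, 1 assembly).

DEFINITION REQUESTS. To file after open (items currently inline the notions): `IsWordLift (Ψ : (Fin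
N → σ) → k) (f : MvPolynomial σ k)` and
`wordFlattening Ψ k l h : Matrix (Fin k → σ) (Fin l → σ) k`, `liftTTRank f N := sInf over lifts of
max flattening rank`
(Nisan 1991 noncommutative ABP width, transported to commutative forms) in
Literature/Computability/AlgebraicComplexity;
cite-fact wanted: Mahajan–Vinay 1997 Thm. 2/§3 (det_m has a homogeneous ABP of width ≤ 2m² with
±x_{ij} edge labels),
MahajanVinay1997 (bib keys Kumar2019, MahajanVinay1997, KumarRamyaSaptharishiTengse2022,
BlaserIkenmeyerMahajanPandeySaurabh2020
added to references.bib by this planner).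

Novelty: Searches (2026-08-15): `lit search --source zbmath "homogeneous algebraic branching programs lower
bound"` (7: Kumar2019,
ChatterjeeKumarSheVolk2022, Chatterjee–Kumar–Volk ITCS 2024 arXiv:2308.04599 det-vs-ABP,
Fournier–Malod–Szusterman–Tavenas 2019,
…); `… "set-multilinear branching programs lower bounds"` (8: Chatterjee–Kush–Saraf–Shpilka CCC 2024
arXiv:2312.15874, Arvind–Raja
2016, Ramya–Rao 2020, …); `… "tensor train rank symmetric tensors"` (6, numerics only); `…
"subspaces of matrices zero
permanent"`, `… "linear spaces permanental hypersurface"`, `… "maximal dimension subspace permanent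
vanishes"` (0 each);
`… "Nullstellensatz degree lower bounds circuit lower bound formulas"` (3: BIKPRS97,
Forbes–Shpilka–Tzameret–Wigderson 2016/2021);
`… "iterated lower bound formulas diagonalization"` (zbmath/crossref: SanthanamTzameret2021 =
doi:10.1145/3406325.3451010,
SICOMP 2025 doi:10.1137/21m1447519); crossref "affine subspaces of matrices on which the permanent
vanishes" (Rubei 2022–2026:
rank conditions, not permanent); `lit vsearch` (books: Krajíček, Proof Complexity §7.5.2 IPS, read
pp.147–156); `lit frontier
ValiantsHypothesis --since 2021` (30 rows: arXiv:2604.00746 multilinear-ABP barrier,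
arXiv:2306.02184 PIT∈NP iff IPS…,
arXiv:2604.22006 non-commutative rings); `lit bridges ValiantsHypothesis --cross any` (surveys/books
only); `lit galaxy search
"iterated lower bound formulas diagonalization" --star all` and `… "Nullstellensatz certificate
permanent algebraic branching  [refs: 10.1145/3406325.3451010, 10.1137/21m1447519, 2308.04599, 2312.15874, 2604.00746, 2306.02184, 2604.22006, 2003.04834, 2012.07056, doi:10.1145/3406325.3451010, doi:10.1137/21m1447519, Kumar2019, ChatterjeeKumarSheVolk2022, SanthanamTzameret2021, Grochow2015, GrochowPitassi2018, ForbesShpilkaVolk2018, Nisan1991]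

Barriers (technique_class: nullstellensatz-certificates, invariant-theory): - technique_class: nullstellensatz-certificates, invariant-theory
- Literature.Barriers.ValiantsHypothesis.AlgebraicNaturalProofs: applies verbatim to PULLBACK
certificates D∘Sym (distinguishers, constant on every fibre of Sym); fibre-specific certificates are
outside the class in letter (they need not extend to a polynomial on Sym^n V vanishing on Sym(N_w));
honest caveat: whether LOW-DEGREE fibre certificates exist where succinct hitting sets would kill
distinguishers is exactly crux PolyDegreeCertificates — the bet, not a theorem.
- Literature.Barriers.ValiantsHypothesis.RankMethods: a Nullstellensatz certificate is not a
sub-additive rank measure μ_L — N/A in letter; but any proof of LiftWidthSuperlinear using only the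
rank of a FIXED linear image of Ψ (e.g. the per-cut two-row projections) is a rank method on V^{⊗n}
and inherits the EGOW18 ceilings; evasion = multipliers of positive degree (nonlinear use of the
minors) and the affine (not linear) constraint Sym Ψ = per_n.
- Literature.Barriers.ValiantsHypothesis.RankLifting: same status as RankMethods (GMOW19 T_k-rank
methods are linear images into k-tensors); the lift is not a linear image of per_n but a preimage,
and TT-rank is minimised over the fibre — outside the class; the bet is that fibre-minimisation is
where per and det separate (width(det_m) ≤ m²+1 vs conjectured 2^{Ω(n)} for per).
- Literature.Barriers.ValiantsHypothesis.PartialDerivativesDetPerm: respected and built in —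
catalecticant (symmetric-lift) ranks

History (route lifecycle, newest last):
- 2026-08-16T04:21:08Z · AUTO-CRUX (backfill): LiftAvoidanceQP — hypotheses of the deciding theorem that nothing in the route derives are cruxes (operator:999:1085951)
- 2026-08-23T20:06:50Z · DORMANT — reconciler: no traction for 6.2 d (last activity item-evidence-added at 2026-08-17T14:29:02Z); parked, not closed — `ledger route dormant route-ValiantsHypothes (operator:999:3988382)
- 2026-08-27T08:46:34Z · REACTIVATED — reconciler: reactivated — activity item-evidence-added at 2026-08-27T07:40:44Z after parking at 2026-08-23T20:06:50Z (operator:999:1508404)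
- 2026-08-29T19:43:20Z · DORMANT — census g0: costume|duplicate of route-ValiantsHypothesis-DetQP; reader census-reader-26-g0 (operator:999:1813533)

sub-problem: ValiantsHypothesis · status: dormant · opened planner-plancard-ValiantsHypothesis-ValiantsH-87e60175-0 2026-08-15T11:43:30Z · rev 1 · ledger route-ValiantsHypothesis-LiftNullstellensatz
GENERATED by the gate from the ledger (D-0016/17). Provers cite these decls: `theorem foo : Summit.ValiantsHypothesis.ValiantsHypothesis.Theses.LiftNullstellensatz.<Decl> := …` in Summits/ValiantsHypothesis/ValiantsHypothesis/Theorems/<Name>.lean.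
-/

namespace Summit.ValiantsHypothesis.ValiantsHypothesis.Theses.LiftNullstellensatz

open scoped BigOperators Topology Manifold Classical MeasureTheory ProbabilityTheory Matrix InnerProductSpace ComplexConjugate ContinuousMap
open Filter Set Function TopologicalSpace MeasureTheory

attribute [summit_statement] _root_.ValiantsHypothesis

open Literature.PNP

/-- item stmt-ValiantsHypothesis-5919 · crux (kind.auto-crux: conjecture-grade) · rank 0 · open · by planner
why it might fail: X is the Extended Valiant Hypothesis VNP ⊄ VQP (BCS97 (21.41), open) in ABP-width form, strictly stronger than VH: false if per_n has homogeneous ABPs of width n^{O(log n)}; known: n/2 < width ≤ C(n,⌊n/2⌋).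
sources: BurgisserClausenShokrollahi1997, Nisan1991, Burgisser2000, Grenet2011, MignonRessayre2004
[target] X as in § Thesis: for every c, eventually every lift Ψ of per_n has a sequential flattening
of rank > 2^((log₂ n + c)^c) (no quasi-polynomial-width homogeneous ABP for the permanent). -/
@[route_item "route-ValiantsHypothesis-LiftNullstellensatz", crux]
def LiftAvoidanceQP : Prop :=
  ∀ c : ℕ, ∃ n₀ : ℕ, ∀ n ≥ n₀, ∀ Ψ : (Fin n → Fin n × Fin n) → ℂ, (∑ w : Fin n → Fin n × Fin n, Ψ w • ∏ t, (MvPolynomial.X (w t) : MvPolynomial (Fin n × Fin n) ℂ)) = Literature.Computability.AlgebraicComplexity.perPoly (Fin n) ℂ → ∃ (k l : ℕ) (h : k + l = n), 2 ^ ((Nat.log 2 n + c) ^ c) < (Matrix.of fun (u : Fin k → Fin n × Fin n) (v : Fin l → Fin n × Fin n) => Ψ (fun t => Fin.append u v (Fin.cast h.symm t))).rank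

/-- item stmt-ValiantsHypothesis-5920 · crux · rank 2 · open · by planner
why it might fail: Nullstellensatz degrees are often linear in the number of variables (here n^{2n}) already for PHP/Tseitin systems (BIKPRS97, Razborov98); short algebraic proofs of 'per is hard' are what GP18/ST21 tie to major conjectures; degree 2^{Ω(n)} kills the mining programme.
sources: SanthanamTzameret2021, GrochowPitassi2018, BussImpagliazzoKrajicekPudlakRazborovSgall1997, Razborov1998, ForbesShpilkaVolk2018, Jelonek2005
[crux] the card's Xi2/Xi3 made falsifiable at the VBP level: for every c there are d, n₀ such that
for all n ≥ n₀ there is a Nullstellensatz certificate of degree ≤ n^d in lift coordinates —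
polynomial multipliers g_p on generators p that are either (n^c+1)-minors of the symbolic sequential
flattenings or the linear equations of the fibre L_n = Sym⁻¹(per_n), with Σ g_p·p = 1 and every
deg(g_p·p) ≤ n^d. By soundness this gives: eventually no lift of per_n has TT-rank ≤ n^c (VNP ⊄
VBP_hom); by Reynolds a certificate of the same degree can be taken S_n×S_n×ℤ/2-invariant, which is
how it is to be FOUND (symmetry-reduced linear algebra at n = 3, 4, then a uniform family).
[difficulty: open-problem] -/
@[route_item "route-ValiantsHypothesis-LiftNullstellensatz"]
def PolyDegreeCertificates : Prop :=
  ∀ c : ℕ, ∃ d n₀ : ℕ, ∀ n ≥ n₀, ∃ (s : Finset (MvPolynomial (Fin n → Fin n × Fin n) ℂ)) (mult : MvPolynomial (Fin n → Fin n × Fin n) ℂ → MvPolynomial (Fin n → Fin n × Fin n) ℂ), (∀ p ∈ s, (p ∈ Set.range fun m : (Fin n × Fin n) →₀ ℕ => MvPolynomial.coeff m ((∑ w : Fin n → Fin n × Fin n, MvPolynomial.C (MvPolynomial.X w) * ∏ t, MvPolynomial.X (w t)) - MvPolynomial.map MvPolynomial.C (Literature.Computability.AlgebraicComplexity.perPoly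 (Fin n) ℂ))) ∨ ∃ (k l : ℕ) (h : k + l = n) (r : Fin (n ^ c + 1) → (Fin k → Fin n × Fin n)) (q : Fin (n ^ c + 1) → (Fin l → Fin n × Fin n)), p = (Matrix.of fun a b => (MvPolynomial.X (fun t => Fin.append (r a) (q b) (Fin.cast h.symm t)) : MvPolynomial (Fin n → Fin n × Fin n) ℂ)).det) ∧ (∀ p ∈ s, (mult p * p).totalDegree ≤ n ^ d) ∧ ∑ p ∈ s, mult p * p = 1

/-- item stmt-ValiantsHypothesis-5921 · crux · rank 3 · open · by planner
why it might fail: width O(n) for per_n is excluded by nothing known (it would give dc(per_n) = O(n²), matching Mignon–Ressayre); all engines stop at linear: Kumar's singular-locus argument (codim sing Z(per_n) ≤ 2n), Hessian via dc ≤ 1+(n−1)·width, flattenings equal for per/det.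
sources: Kumar2019, ChatterjeeKumarSheVolk2022, MignonRessayre2004, vonzurGathen1987, Landsberg2017, Nisan1991
[crux] first unconditional rung past every known engine: there is ε > 0 such that for all large n
every lift Ψ of per_n has a sequential flattening of rank ≥ n^{1+ε} (homogeneous ABP width of per_n
is superlinear). Any proof must use the COUPLING of the cuts through one lift (the per-cut
two-row/Pieri projection is only the decoupled product rank, stuck at the singular-locus ceiling) or
a certificate of degree ≥ 1 in the minors. [difficulty: XL] -/
@[route_item "route-ValiantsHypothesis-LiftNullstellensatz"]
def LiftWidthSuperlinear : Prop :=
  ∃ ε : ℝ, 0 < ε ∧ ∃ n₀ : ℕ, ∀ n ≥ n₀, ∀ Ψ : (Fin n → Fin n × Fin n) → ℂ, (∑ w : Fin n → Fin n × Fin n, Ψ w • ∏ t, (MvPolynomial.X (w t) : MvPolynomial (Fin n × Fin n) ℂ)) = Literature.Computability.AlgebraicComplexity.perPoly (Fin n) ℂ → ∃ (k l : ℕ) (h : k + l = n), (n : ℝ) ^ (1 + ε) ≤ (((Matrix.of fun (u : Fin k → Fin n × Fin n) (v : Fin l → Fin n × Fin n) => Ψ (fun t => Fin.append u v (Fin.cast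 h.symm t))).rank : ℕ) : ℝ)

/-- item stmt-ValiantsHypothesis-5922 · crux · rank 4 · open · by planner
why it might fail: per_4 may have a non-Grenet lift of middle rank 5 (16·(4+20+20+4) = 768 unknowns vs C(19,4) = 3876 equations; numerically searchable); only width ≥ 3 is known, and small cases do surprise (product rank of per_3 is 4 < naive, IltenTeitler2016).
sources: Grenet2011, AlperBogartVelasco2017, IltenTeitler2016, BlaserIkenmeyerMahajanPandeySaurabh2020, Kumar2019
[crux] calibration point of the mining programme (analogue of dc(per_3) = 7): Grenet's width C(4,2)
= 6 is optimal for per_4 — every lift of per_4 has a sequential flattening of rank ≥ 6 (equivalently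
no homogeneous ABP of widths (≤5, ≤5, ≤5)). The first instance where neither Kumar+von zur Gathen (≥
3) nor dc(per_4) ≥ 8 decides; a proof is expected to BE an invariant certificate at (n, w) = (4, 5),
the data from which the uniform family is read. [difficulty: L] -/
@[route_item "route-ValiantsHypothesis-LiftNullstellensatz"]
def LiftWidthPerFour : Prop :=
  ∀ Ψ : (Fin 4 → Fin 4 × Fin 4) → ℂ, (∑ w : Fin 4 → Fin 4 × Fin 4, Ψ w • ∏ t, (MvPolynomial.X (w t) : MvPolynomial (Fin 4 × Fin 4) ℂ)) = Literature.Computability.AlgebraicComplexity.perPoly (Fin 4) ℂ → ∃ (k l : ℕ) (h : k + l = 4), 6 ≤ (Matrix.of fun (u : Fin k → Fin 4 × Fin 4) (v : Fin l → Fin 4 × Fin 4) => Ψ (fun t => Fin.append u v (Fin.cast h.symm t))).rank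

/-- item stmt-ValiantsHypothesis-5923 · support · rank 9 · closed · proved by Summit.ValiantsHypothesis.ValiantsHypothesis.Theorems.LiftNullstellensatzPerLiftQPOfVP.perLiftQPOfVP_proof @ 693c96ac9506 (prover) · by planner
sources: BurgisserClausenShokrollahi1997, ValiantSkyumBerkowitzRackoff1983, Valiant1979, MahajanVinay1997, Berkowitz1984, Nisan1991
[support] assembly glue (known in print): if the permanent family is a VP family then per_n has
lifts of quasi-polynomial TT-rank — VP ⊆ VQP = qp-size formulas (VSBR83 + Hyafil; BCS97 Thm (21.33),
in tree as the PROVED fact isQPBounded_determinantalComplexity_of_isVPFamily_holds) and a formula /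
determinantal representation of size s yields a homogeneous ABP, hence a lift, of width poly(s)
(Valiant's series–parallel construction or Mahajan–Vinay/Berkowitz for det_m, then substitution +
homogenisation: rank ≤ (m+1)·(m²+1)). [difficulty: L] -/
@[route_item "route-ValiantsHypothesis-LiftNullstellensatz", crux]
def PerLiftQPOfVP : Prop :=
  Literature.Computability.AlgebraicComplexity.IsVPFamily (fun n => Literature.Computability.AlgebraicComplexity.perPoly (Fin n) ℂ) → ∃ c : ℕ, ∀ n : ℕ, ∃ Ψ : (Fin n → Fin n × Fin n) → ℂ, (∑ w : Fin n → Fin n × Fin n, Ψ w • ∏ t, (MvPolynomial.X (w t) : MvPolynomial (Fin n × Fin n) ℂ)) = Literature.Computability.AlgebraicComplexity.perPoly (Fin n) ℂ ∧ ∀ (k l : ℕ) (h : k + l = n), (Matrix.of fun (u : Fin k → Fin n × Fin n) (v : Fin l → Fin n × Fin n) => Ψ (fun t => Fin.append u v (Fin.cast h.symm t))).rank ≤ 2 ^ ((Nat.log 2 n + c) ^ c)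

-- `PerLiftQPOfVP` holds: proved by `Summit.ValiantsHypothesis.ValiantsHypothesis.Theorems.LiftNullstellensatzPerLiftQPOfVP.perLiftQPOfVP_proof` @ 693c96ac9506 (its module imports this route file, so no `_holds` link can be stated here).

/-- item stmt-ValiantsHypothesis-5924 · support · rank 9 · closed · proved by Summit.ValiantsHypothesis.ValiantsHypothesis.Theorems.detReprLift_proof @ 2666c173660a (prover) · by planner
sources: MahajanVinay1997, Berkowitz1984, Nisan1991, MignonRessayre2004
[support] the natural general form of the glue: there is d such that every form f, homogeneous of
degree N, with an affine determinantal representation of size m has a word lift of length N with all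
sequential flattening ranks ≤ (m+2)^d (lift of det_m of TT-rank ≤ m²+1 by Mahajan–Vinay clow
sequences or Le Verrier/Newton identities; substitute the affine entries, expand, keep the degree-N
words: rank ≤ (m+1)(m²+1)). With the proved cone facts (VP ⇒ qp dc, dc attained) it yields
PerLiftQPOfVP. [difficulty: L] -/
@[route_item "route-ValiantsHypothesis-LiftNullstellensatz"]
def DetReprLift : Prop :=
  ∃ d : ℕ, ∀ (σ : Type) [Fintype σ] (N m : ℕ) (f : MvPolynomial σ ℂ), f.IsHomogeneous N → Literature.Computability.AlgebraicComplexity.HasDetRepr f m → ∃ Ψ : (Fin N → σ) → ℂ, (∑ w : Fin N → σ, Ψ w • ∏ t, (MvPolynomial.X (w t) : MvPolynomial σ ℂ)) = f ∧ ∀ (k l : ℕ) (h : k + l = N), (Matrix.of fun (u : Fin k → σ) (v : Fin l → σ) => Ψ (fun t => Fin.append u v (Fin.cast h.symm t))).rank ≤ (m + 2) ^ d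

-- `DetReprLift` holds: proved by `Summit.ValiantsHypothesis.ValiantsHypothesis.Theorems.detReprLift_proof` @ 2666c173660a (its module imports this route file, so no `_holds` link can be stated here).

/-- item stmt-ValiantsHypothesis-5925 · support · rank 9 · closed · proved by Summit.ValiantsHypothesis.LiftNullstellensatz.LiftWidthGeThree_proof (prover) · by planner
sources: Kumar2019, vonzurGathen1987, ChatterjeeKumarSheVolk2022
[support] the rung available now: for n ≥ 3 every lift of per_n has a sequential flattening of rank
≥ 3 (in particular Grenet's width C(3,1) = 3 is optimal for per_3). Proof in hand: a cut of rank r ≤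
2 writes per_n = g₁h₁ + g₂h₂ with homogeneous g_i, h_i of positive degree, so I = (g₁,g₂,h₁,h₂) ∋
per_n and all ∂per_n; a minimal prime over I has height ≤ 4 (Krull, Mathlib) but ≥ 5 (von zur Gathen
1987 Lemma 2.3 = PROVED tree fact vonzurGathen1987_singPerm_height_holds) — Kumar's homogeneous-ABP
argument. [difficulty: provable-now] -/
@[route_item "route-ValiantsHypothesis-LiftNullstellensatz"]
def LiftWidthGeThree : Prop :=
  ∀ n ≥ 3, ∀ Ψ : (Fin n → Fin n × Fin n) → ℂ, (∑ w : Fin n → Fin n × Fin n, Ψ w • ∏ t, (MvPolynomial.X (w t) : MvPolynomial (Fin n × Fin n) ℂ)) = Literature.Computability.AlgebraicComplexity.perPoly (Fin n) ℂ → ∃ (k l : ℕ) (h : k + l = n), 3 ≤ (Matrix.of fun (u : Fin k → Fin n × Fin n) (v : Fin l → Fin n × Fin n) => Ψ (fun t => Fin.append u v (Fin.cast h.symm t))).rank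

-- `LiftWidthGeThree` holds: proved by `Summit.ValiantsHypothesis.LiftNullstellensatz.LiftWidthGeThree_proof` (its module imports this route file, so no `_holds` link can be stated here).

/-- item stmt-ValiantsHypothesis-5926 · assembly · rank 1 · closed · proved by Summit.ValiantsHypothesis.ValiantsHypothesis.Theorems.LiftNullstellensatzAssembly.assembly_proof @ bc2ea7a8e3ae (prover) · by planner
sources: BurgisserClausenShokrollahi1997, Valiant1979, Nisan1991
[assembly] LiftAvoidanceQP → PerLiftQPOfVP → ValiantsHypothesis. -/
@[route_item "route-ValiantsHypothesis-LiftNullstellensatz"]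
def Assembly : Prop :=
  LiftAvoidanceQP → PerLiftQPOfVP → ValiantsHypothesis

-- `Assembly` holds: proved by `Summit.ValiantsHypothesis.ValiantsHypothesis.Theorems.LiftNullstellensatzAssembly.assembly_proof` @ bc2ea7a8e3ae (its module imports this route file, so no `_holds` link can be stated here).

/-! D-0027 §2.1 — DECIDING THEOREM (planner-authored via `route open/edit --closes-file`; by planner-rbadge-ValiantsHypothesis-LiftNullstel-df9a87d3-g2-0 2026-08-15T16:13:45Z):
its hypotheses are this route's items and its conclusion the sub-problem Statement (glue_lint), and it elaborates with this file. -/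

@[closes "route-ValiantsHypothesis-LiftNullstellensatz"] theorem closes (h_LiftAvoidanceQP : LiftAvoidanceQP) (h_PerLiftQPOfVP : PerLiftQPOfVP) :
    _root_.ValiantsHypothesis := by
  show Literature.Computability.AlgebraicComplexity.VP ℂ ≠ Literature.Computability.AlgebraicComplexity.VNP ℂ
  intro hEq
  -- Valiant 1979: the permanent family is in VNP (proved Literature fact).
  have hVNP := Literature.Computability.AlgebraicComplexity.perFamily_mem_VNP_holds ℂ
  have hVP : Literature.Computability.AlgebraicComplexity.perFamily ℂ ∈
      Literature.Computability.AlgebraicComplexity.VP ℂ := by rw [hEq]; exact hVNP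
  -- renaming bridge: bundled family ∈ VP ↔ IsVPFamily (per_n)
  have hfam : Literature.Computability.AlgebraicComplexity.IsVPFamily
      (fun n => Literature.Computability.AlgebraicComplexity.perPoly (Fin n) ℂ) :=
    (Literature.Computability.AlgebraicComplexity.mem_VP_ofFintype_iff_holds _).1 hVP
  -- VP ⇒ lifts of quasi-polynomial TT-rank (item PerLiftQPOfVP) ...
  obtain ⟨c, hc⟩ := h_PerLiftQPOfVP hfam
  -- ... contradicting lift avoidance at this exponent c (item LiftAvoidanceQP).
  obtain ⟨n₀, hn₀⟩ := h_LiftAvoidanceQP c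
  obtain ⟨Ψ, hΨ, hrank⟩ := hc n₀
  obtain ⟨k, l, h, hlt⟩ := hn₀ n₀ le_rfl Ψ hΨ
  exact absurd hlt (not_lt.mpr (hrank k l h))

end Summit.ValiantsHypothesis.ValiantsHypothesis.Theses.LiftNullstellensatz
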